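import Mathlib
import HarnessLib
import Summits.HubbardSuperconductivity.HubbardSuperconductivity.Theorems.KLProgrammeC4aTangencyCalculus

/-!
# Route `KLProgramme` — crux C4a, S3 brick (B2, TANGENCY, ALL ORDERS): carrier-free calculus — every co-moving jet of
# `t ↦ f(2Γ(θ+t) − Γ(φ+θ+t))` vanishes to SECOND order in the loop angle `φ` when `Γ` lies in a level set of `f`

Cell `gate-hubbard-kl`, seat hubbard-kl-k3c3-p3 (g23; row «implicit-function / monotonicity route»).  Located brick «(B2)-TAN-ALL» for
the (C)-closer lane hubbard-kl-c4a-1 (stub (C) `stub_twoLeg_curvature` of `KLRegimeEngineV17F2`, stmt-HubbardSuperconductivity-20437;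
memo HOME/hubbard-kl-c4a-1/C4A-PLAN.md §24.4 (ii), §24.8 «Orders 3, 4 at (T) need f ∈ C⁵, C⁶ and Γ-tables D₅, D₆», §24.9 «(B2) STATUS …
OPEN: orders 3–4 at (T)»).  The order-1 and order-2 files `…C4aTangencyCalculus` (`abs_deriv_tangency_core_le`) and
`…C4aTangencyCalculusTwo` (`abs_iteratedDeriv_two_tangency_core_le`) expand the jet in monomials; here ONE device gives every order.

THE DEVICE.  On `ℝ²` put `P(α, β) := f(2Γ(α) − Γ(β))`.  The diagonal `β = α` is DOUBLY CHARACTERISTIC: `P(α, α) = f(Γ α) = c` is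
constant and `∂_β P(α, α) = −Df(Γ α)[Γ′ α] = −(f∘Γ)′(α) = 0` — the two level-curve (implicit-function) identities.  The partner band
at the tangency configuration is `t ↦ P((θ,θ) + φ·(0,1) + t·(1,1))`, so its `t`-jets are the jets of `P` along the direction `v = (1,1)`
at distance `φ` (direction `w = (0,1)`) from the characteristic line.  ABSTRACTLY (§2): if `P` is constant along the line `q + ℝv` and
`∂_w P` vanishes along it, then EVERY tangential jet `D^n P(q + φw)[v,…,v]` vanishes to second order in `φ`:
`|D^n P(q + φw)[vⁿ]| ≤ sup‖D^{n+2}P‖·‖w‖²·‖v‖ⁿ·φ²` — because `s ↦ D^nP(q + sw)[vⁿ]` vanishes at `s = 0` together with its first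
derivative `D^{n+1}P(q)[w, vⁿ]`, the latter after moving `w` past the `v`'s by Clairaut's symmetry (§1: Mathlib has the symmetry of
`iteratedFDeriv` only at order two (`IsSymmSndFDerivAt`) and for analytic maps; the adjacent slot swap at every order is typed here),
and the landed Taylor estimate `abs_le_sq_of_hasDerivAt_two`.

* §1 `iteratedFDeriv_succ_succ_apply_swap` (Clairaut slot swap), `iteratedDeriv_comp_line` (jets along a line), `hasDerivAt_iteratedFDeriv_line`,
  `iteratedFDeriv_line_eq_zero_of_eq_zero`, `iteratedFDeriv_line_cons_eq_zero` (vanishing along a line propagates to all tangential jets);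
* §2 **`abs_iteratedFDeriv_line_le_sq`** — the quadratic-vanishing transfer;
* §3 **`abs_iteratedDeriv_tangency_core_le_of_order`** — `|∂ⁿ_t|₀ f(Γ(θ+t) + Γ(θ+t) − Γ(φ+θ+t))| ≤ (n+2)!·K·(3D)^{n+2}·φ²` for `f, Γ ∈ C^{n+2}`,
  `‖Dⁱf‖ ≤ K`, `‖Γ⁽ⁱ⁾‖ ≤ Dⁱ` (`1 ≤ i ≤ n+2`), `f ∘ Γ` constant — ALL ORDERS `n` (orders 3, 4 are the located need; at `n = 1, 2` it is a
  one-term form of the landed constants);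
* (sequel `…C4aJetComparisonAll`: the all-orders jet comparison `|∂ⁿ_t f(X + δ•Δ) − ∂ⁿ_t f(X)|₀ ≤ |δ|·(n+1)!·K·D^{n+1}` by the same line
  calculus — the reductions `e → 0`, `(ρ,ϑ) → (ρ_T,ϑ_T)` of the instance files at every order.)

Pure calculus (Mathlib + the landed order-1 file); nothing about the model's sizes; nothing asserts superconductivity.
References: FST II = Feldman–Salmhofer–Trubowitz CPAM 51 (1998) §3 (tangential regularity at `2k_F`); BGM 2006 §2.4 [cite: BenfattoGiulianiMastropietro2006].
-/

noncomputable section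

namespace Summit.HubbardSuperconductivity.HubbardSuperconductivity.Theorems.C4a

set_option linter.dupNamespace false -- summit = problem name (single-conjunct summit), D-0017

open Real Set Filter
open scoped Topology

/-! ## §1 Jets along a line: identification, derivative in the base point, Clairaut slot swap, propagation of vanishing -/

/-- The constant tuple of length `n+1` is `cons` of the constant tuple of length `n`. -/
theorem const_eq_cons {α : Type*} (v : α) (n : ℕ) : (fun _ : Fin (n + 1) => v) = Fin.cons v (fun _ : Fin n => v) := by
  funext i
  refine Fin.cases ?_ (fun j => ?_) i
  · simp only [Fin.cons_zero]
  · simp only [Fin.cons_succ]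

section Line

variable {E F : Type*} [NormedAddCommGroup E] [NormedSpace ℝ E] [NormedAddCommGroup F] [NormedSpace ℝ F]

/-- **Clairaut slot swap**: for `P ∈ C^{n+2}` the `(n+2)`-nd Fréchet derivative is symmetric in its first two slots.
(Mathlib: `ContDiffAt.isSymmSndFDerivAt` for the second derivative of `y ↦ DⁿP(y)[m]`.) [folklore] -/
theorem iteratedFDeriv_succ_succ_apply_swap {P : E → F} {n : ℕ} {N : WithTop ℕ∞} (hP : ContDiff ℝ N P)
    (hn : ((n + 2 : ℕ) : WithTop ℕ∞) ≤ N) (x a b : E) (m : Fin n → E) :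
    iteratedFDeriv ℝ (n + 2) P x (Fin.cons a (Fin.cons b m)) = iteratedFDeriv ℝ (n + 2) P x (Fin.cons b (Fin.cons a m)) := by
  have hP2 : ContDiff ℝ (n + 2 : ℕ) P := hP.of_le hn
  set φ : E → F := fun z => iteratedFDeriv ℝ n P z m with hφ
  have hPn : ContDiff ℝ 2 (iteratedFDeriv ℝ n P) := hP2.iteratedFDeriv_right (m := 2) (i := n) (by push_cast; rw [add_comm])
  have hφ2 : ContDiff ℝ 2 φ := (ContinuousMultilinearMap.apply ℝ (fun _ : Fin n => E) F m).contDiff.comp hPn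
  have hdn : Differentiable ℝ (iteratedFDeriv ℝ n P) :=
    hP2.differentiable_iteratedFDeriv (by exact_mod_cast (show n < n + 2 by omega))
  have hdn1 : Differentiable ℝ (iteratedFDeriv ℝ (n + 1) P) :=
    hP2.differentiable_iteratedFDeriv (by exact_mod_cast (show n + 1 < n + 2 by omega))
  have hdφ : Differentiable ℝ (fderiv ℝ φ) := (hφ2.fderiv_right (m := 1) (by norm_num)).differentiable one_ne_zero
  -- level `n+1` at every base point: `D^{n+1}P(y)[c, m] = ∂_c φ(y)`
  have h1 : ∀ y c : E, iteratedFDeriv ℝ (n + 1) P y (Fin.cons c m) = fderiv ℝ φ y c := fun y c => by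
    rw [(hdn y).iteratedFDeriv_succ_apply_left']
    simp only [Fin.cons_zero, Fin.tail_cons, hφ]
  -- level `n+2`: `D^{n+2}P(x)[c, d, m] = ∂_c ∂_d φ(x)`
  have h2 : ∀ c d : E, iteratedFDeriv ℝ (n + 2) P x (Fin.cons c (Fin.cons d m)) = fderiv ℝ (fderiv ℝ φ) x c d := fun c d => by
    rw [(hdn1 x).iteratedFDeriv_succ_apply_left']
    simp only [Fin.cons_zero, Fin.tail_cons]
    have hfun : (fun y => iteratedFDeriv ℝ (n + 1) P y (Fin.cons d m)) = fun y => fderiv ℝ φ y d := funext fun y => h1 y d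
    rw [hfun, fderiv_clm_apply (hdφ x) (differentiableAt_const d)]
    simp only [fderiv_fun_const, Pi.zero_apply, ContinuousLinearMap.comp_zero, zero_add, ContinuousLinearMap.flip_apply]
  rw [h2, h2]
  exact hφ2.contDiffAt.isSymmSndFDerivAt (by simp) a b

/-- **Jets along a line are the iterated Fréchet derivative on the constant tuple**: `∂ⁿ_t P(q + t v)|_{t=s} = DⁿP(q + s v)[v,…,v]`. -/
theorem iteratedDeriv_comp_line (P : E → F) {n : ℕ} {N : WithTop ℕ∞} (hP : ContDiff ℝ N P) (hn : (n : WithTop ℕ∞) ≤ N)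
    (q v : E) (s : ℝ) :
    iteratedDeriv n (fun t : ℝ => P (q + t • v)) s = iteratedFDeriv ℝ n P (q + s • v) (fun _ => v) := by
  have hL : (fun t : ℝ => P (q + t • v)) = (fun z : E => P (q + z)) ∘ (ContinuousLinearMap.toSpanSingleton ℝ v) := by
    funext t; simp only [Function.comp_apply, ContinuousLinearMap.toSpanSingleton_apply]
  have hq : ContDiff ℝ N (fun z : E => P (q + z)) := hP.comp (contDiff_const.add contDiff_id)
  rw [iteratedDeriv_eq_iteratedFDeriv, hL, ContinuousLinearMap.iteratedFDeriv_comp_right _ hq _ hn,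
    ContinuousMultilinearMap.compContinuousLinearMap_apply]
  simp only [ContinuousLinearMap.toSpanSingleton_apply, one_smul]
  rw [iteratedFDeriv_comp_add_left]

/-- **Moving the base point along a direction `w` differentiates the jet**: `d/dσ DⁿP(q + σw)[m] = D^{n+1}P(q + σw)[w, m]`. -/
theorem hasDerivAt_iteratedFDeriv_line {P : E → F} {n : ℕ} {N : WithTop ℕ∞} (hP : ContDiff ℝ N P)
    (hn : ((n + 1 : ℕ) : WithTop ℕ∞) ≤ N) (q w : E) (m : Fin n → E) (s : ℝ) :
    HasDerivAt (fun σ : ℝ => iteratedFDeriv ℝ n P (q + σ • w) m) (iteratedFDeriv ℝ (n + 1) P (q + s • w) (Fin.cons w m)) s := by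
  have hP1 : ContDiff ℝ (n + 1 : ℕ) P := hP.of_le hn
  have hdn : Differentiable ℝ (iteratedFDeriv ℝ n P) := hP1.differentiable_iteratedFDeriv (by exact_mod_cast lt_add_one n)
  have hline : HasDerivAt (fun σ : ℝ => q + σ • w) w s := by
    simpa using ((hasDerivAt_id s).smul_const w).const_add q
  have h1 : HasDerivAt (fun σ : ℝ => iteratedFDeriv ℝ n P (q + σ • w)) (fderiv ℝ (iteratedFDeriv ℝ n P) (q + s • w) w) s :=
    (hdn _).hasFDerivAt.comp_hasDerivAt s hline
  have h2 := (ContinuousMultilinearMap.apply ℝ (fun _ : Fin n => E) F m).hasFDerivAt.comp_hasDerivAt s h1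
  have e1 : ((ContinuousMultilinearMap.apply ℝ (fun _ : Fin n => E) F m) ∘ fun σ : ℝ => iteratedFDeriv ℝ n P (q + σ • w)) =
      fun σ : ℝ => iteratedFDeriv ℝ n P (q + σ • w) m := by
    funext σ; simp only [Function.comp_apply, ContinuousMultilinearMap.apply_apply]
  have e2 : (ContinuousMultilinearMap.apply ℝ (fun _ : Fin n => E) F m) (fderiv ℝ (iteratedFDeriv ℝ n P) (q + s • w) w) =
      iteratedFDeriv ℝ (n + 1) P (q + s • w) (Fin.cons w m) := by
    rw [ContinuousMultilinearMap.apply_apply, iteratedFDeriv_succ_apply_left]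
    simp only [Fin.cons_zero, Fin.tail_cons]
  rwa [e1, e2] at h2

/-- **A function vanishing along a line has all tangential jets zero there**: `P(q + tv) = 0 ∀t ⇒ DⁿP(q + tv)[vⁿ] = 0`. -/
theorem iteratedFDeriv_line_eq_zero_of_eq_zero {P : E → F} {n : ℕ} {N : WithTop ℕ∞} (hP : ContDiff ℝ N P)
    (hn : (n : WithTop ℕ∞) ≤ N) (q v : E) (h0 : ∀ t : ℝ, P (q + t • v) = 0) (t : ℝ) :
    iteratedFDeriv ℝ n P (q + t • v) (fun _ => v) = 0 := by
  rw [← iteratedDeriv_comp_line P hP hn q v t, show (fun t : ℝ => P (q + t • v)) = fun _ => (0 : F) from funext h0, iteratedDeriv_const]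
  simp

/-- **If `∂_w P` vanishes along the line `q + ℝv` then `D^{n+1}P(q + tv)[w, v, …, v] = 0`** — `w` in the OUTER slot, by induction with one
Clairaut swap per order: `D^{j+2}P[w, v, vʲ] = D^{j+2}P[v, w, vʲ] = d/dt D^{j+1}P(q+tv)[w, vʲ] = 0`. -/
theorem iteratedFDeriv_line_cons_eq_zero {P : E → F} {n : ℕ} {N : WithTop ℕ∞} (hP : ContDiff ℝ N P)
    (hn : ((n + 1 : ℕ) : WithTop ℕ∞) ≤ N) (q v w : E) (h1 : ∀ t : ℝ, fderiv ℝ P (q + t • v) w = 0) (t : ℝ) :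
    iteratedFDeriv ℝ (n + 1) P (q + t • v) (Fin.cons w (fun _ => v)) = 0 := by
  induction n generalizing t with
  | zero =>
    rw [iteratedFDeriv_one_apply]
    simpa only [Fin.cons_zero] using h1 t
  | succ k ih =>
    have hk : ((k + 1 : ℕ) : WithTop ℕ∞) ≤ N := le_trans (by exact_mod_cast Nat.le_succ _) hn
    rw [const_eq_cons v k, iteratedFDeriv_succ_succ_apply_swap hP hn (q + t • v) w v _]
    have hg : HasDerivAt (fun σ : ℝ => iteratedFDeriv ℝ (k + 1) P (q + σ • v) (Fin.cons w fun _ => v))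
        (iteratedFDeriv ℝ (k + 2) P (q + t • v) (Fin.cons v (Fin.cons w fun _ => v))) t :=
      hasDerivAt_iteratedFDeriv_line hP hn q v _ t
    have hz : (fun σ : ℝ => iteratedFDeriv ℝ (k + 1) P (q + σ • v) (Fin.cons w fun _ => v)) = fun _ => (0 : F) :=
      funext fun σ => ih hk σ
    rw [hz] at hg
    exact hg.unique (hasDerivAt_const t (0 : F)) ▸ rfl

end Line

/-! ## §2 Quadratic vanishing off a doubly-characteristic line transfers to every tangential jet -/

section Transfer

variable {E : Type*} [NormedAddCommGroup E] [NormedSpace ℝ E]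

/-- **QUADRATIC VANISHING OF ALL TANGENTIAL JETS.**  Let `P ∈ C^{n+2}(E; ℝ)`, `q, v, w ∈ E` with `P(q + tv) = 0` and `∂_w P(q + tv) = 0` for all
`t`, and `‖D^{n+2}P(q + sw)‖ ≤ M` for `|s| ≤ |φ|`.  Then `|∂ⁿ_t|₀ P(q + φw + tv)| ≤ M·‖w‖²·‖v‖ⁿ·φ²`. [folklore; the implicit-function
mechanism of FST II §3 at every order] -/
theorem abs_iteratedFDeriv_line_le_sq {P : E → ℝ} {n : ℕ} {N : WithTop ℕ∞} (hP : ContDiff ℝ N P) (hn : ((n + 2 : ℕ) : WithTop ℕ∞) ≤ N)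
    (q v w : E) (h0 : ∀ t : ℝ, P (q + t • v) = 0) (h1 : ∀ t : ℝ, fderiv ℝ P (q + t • v) w = 0)
    {M φ : ℝ} (hM : ∀ s : ℝ, |s| ≤ |φ| → ‖iteratedFDeriv ℝ (n + 2) P (q + s • w)‖ ≤ M) :
    |iteratedDeriv n (fun t : ℝ => P (q + φ • w + t • v)) 0| ≤ M * ‖w‖ ^ 2 * ‖v‖ ^ n * φ ^ 2 := by
  have hn1 : ((n + 1 : ℕ) : WithTop ℕ∞) ≤ N := le_trans (by exact_mod_cast Nat.le_succ _) hn
  have hn0 : (n : WithTop ℕ∞) ≤ N := le_trans (by exact_mod_cast Nat.le_succ _) hn1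
  rw [iteratedDeriv_comp_line P hP hn0 (q + φ • w) v 0, zero_smul, add_zero]
  -- the function `g(s) = DⁿP(q + s w)[vⁿ]`, its derivative `g₁(s) = D^{n+1}P(q + s w)[w, vⁿ]` and `g₂(s) = D^{n+2}P(q + s w)[w, w, vⁿ]`
  have hg : ∀ s : ℝ, HasDerivAt (fun σ : ℝ => iteratedFDeriv ℝ n P (q + σ • w) (fun _ => v))
      (iteratedFDeriv ℝ (n + 1) P (q + s • w) (Fin.cons w fun _ => v)) s := fun s => hasDerivAt_iteratedFDeriv_line hP hn1 q w _ s
  have hg₁ : ∀ s : ℝ, HasDerivAt (fun σ : ℝ => iteratedFDeriv ℝ (n + 1) P (q + σ • w) (Fin.cons w fun _ => v))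
      (iteratedFDeriv ℝ (n + 2) P (q + s • w) (Fin.cons w (Fin.cons w fun _ => v))) s := fun s =>
    hasDerivAt_iteratedFDeriv_line hP hn q w _ s
  have hg0 : (fun σ : ℝ => iteratedFDeriv ℝ n P (q + σ • w) (fun _ => v)) 0 = 0 := by
    have h := iteratedFDeriv_line_eq_zero_of_eq_zero hP hn0 q v h0 0
    simp only [zero_smul, add_zero] at h ⊢
    exact h
  have hg₁0 : (fun σ : ℝ => iteratedFDeriv ℝ (n + 1) P (q + σ • w) (Fin.cons w fun _ => v)) 0 = 0 := by
    have h := iteratedFDeriv_line_cons_eq_zero hP hn1 q v w h1 0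
    simp only [zero_smul, add_zero] at h ⊢
    exact h
  have hg₂ : ∀ s : ℝ, |s| ≤ |φ| → |iteratedFDeriv ℝ (n + 2) P (q + s • w) (Fin.cons w (Fin.cons w fun _ => v))| ≤ M * ‖w‖ ^ 2 * ‖v‖ ^ n :=
    fun s hs => by
    rw [← Real.norm_eq_abs]
    refine (ContinuousMultilinearMap.le_opNorm _ _).trans ?_
    rw [Fin.prod_univ_succ, Fin.prod_univ_succ]
    simp only [Fin.cons_zero, Fin.cons_succ, Fin.prod_const]
    have hM0 := hM s hs
    calc ‖iteratedFDeriv ℝ (n + 2) P (q + s • w)‖ * (‖w‖ * (‖w‖ * ‖v‖ ^ n)) ≤ M * (‖w‖ * (‖w‖ * ‖v‖ ^ n)) := by gcongr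
      _ = M * ‖w‖ ^ 2 * ‖v‖ ^ n := by ring
  have h := abs_le_sq_of_hasDerivAt_two hg hg₁ hg0 hg₁0 hg₂
  simpa only [mul_assoc] using h

end Transfer

/-! ## §3 The tangency core at every order -/

section Core

variable {V : Type*} [NormedAddCommGroup V] [NormedSpace ℝ V]

/-- Along a curve inside a level set of `f`, the tangential derivative of `f` vanishes: `Df(Γ s)[Γ′ s] = 0`. -/
theorem fderiv_apply_deriv_eq_zero_of_level {f : V → ℝ} (hf : Differentiable ℝ f) {Γ : ℝ → V} (hΓ : Differentiable ℝ Γ) {c : ℝ}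
    (hΓc : ∀ s, f (Γ s) = c) (s : ℝ) : fderiv ℝ f (Γ s) (deriv Γ s) = 0 := by
  have h1 : HasDerivAt (fun s : ℝ => f (Γ s)) (fderiv ℝ f (Γ s) (deriv Γ s)) s :=
    (hf (Γ s)).hasFDerivAt.comp_hasDerivAt s (hΓ s).hasDerivAt
  have h2 : HasDerivAt (fun s : ℝ => f (Γ s)) 0 s := by
    rw [show (fun s : ℝ => f (Γ s)) = fun _ => c from funext hΓc]; exact hasDerivAt_const s c
  exact h1.unique h2

/-- Derivatives of `x ↦ Γ(A x)` for a continuous linear form `A` of norm `≤ 1`: `‖Dⁱ(Γ ∘ A)(x)‖ ≤ ‖Γ⁽ⁱ⁾(A x)‖`. -/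
theorem norm_iteratedFDeriv_comp_clm_le {E : Type*} [NormedAddCommGroup E] [NormedSpace ℝ E] {Γ : ℝ → V} {N : WithTop ℕ∞}
    (hΓ : ContDiff ℝ N Γ) (A : E →L[ℝ] ℝ) (hA : ‖A‖ ≤ 1) {i : ℕ} (hi : (i : WithTop ℕ∞) ≤ N) (x : E) :
    ‖iteratedFDeriv ℝ i (fun y => Γ (A y)) x‖ ≤ ‖iteratedDeriv i Γ (A x)‖ := by
  rw [show (fun y => Γ (A y)) = Γ ∘ A from rfl, A.iteratedFDeriv_comp_right hΓ x hi, ← norm_iteratedFDeriv_eq_norm_iteratedDeriv]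
  refine (ContinuousMultilinearMap.norm_compContinuousLinearMap_le _ _).trans ?_
  have hprod : ∏ _i : Fin i, ‖A‖ ≤ 1 := Finset.prod_le_one (fun _ _ => norm_nonneg _) (fun _ _ => hA)
  calc ‖iteratedFDeriv ℝ i Γ (A x)‖ * ∏ _i : Fin i, ‖A‖ ≤ ‖iteratedFDeriv ℝ i Γ (A x)‖ * 1 := by gcongr
    _ = ‖iteratedFDeriv ℝ i Γ (A x)‖ := mul_one _

/-- **THE TANGENCY CORE AT EVERY ORDER.**  For `f ∈ C^{n+2}` with `‖Dⁱf‖ ≤ K` (`1 ≤ i ≤ n+2`), a `C^{n+2}` curve `Γ` in the zero level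
of `f` with `‖Γ⁽ⁱ⁾‖ ≤ Dⁱ` (`1 ≤ i ≤ n+2`), and all `θ, φ`:
`|∂ⁿ_t|₀ f(Γ(θ+t) + Γ(θ+t) − Γ(φ+θ+t))| ≤ (n+2)!·K·(3D)^{n+2}·φ²` — the `n`-th co-moving jet of the pp partner band at the tangency
configuration vanishes to second order in the loop angle (ph: the same function, see the instance file).  [FST II §3 mechanism, all orders] -/
theorem abs_iteratedDeriv_tangency_core_le_of_order {f : V → ℝ} {n : ℕ} {N : WithTop ℕ∞} (hf : ContDiff ℝ N f)
    (hn : ((n + 2 : ℕ) : WithTop ℕ∞) ≤ N) {K : ℝ} (hK : ∀ i, 1 ≤ i → i ≤ n + 2 → ∀ x, ‖iteratedFDeriv ℝ i f x‖ ≤ K)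
    {Γ : ℝ → V} (hΓ : ContDiff ℝ N Γ) (hΓ0 : ∀ s, f (Γ s) = 0)
    {D : ℝ} (hD : ∀ i, 1 ≤ i → i ≤ n + 2 → ∀ s, ‖iteratedDeriv i Γ s‖ ≤ D ^ i) (θ φ : ℝ) :
    |iteratedDeriv n (fun t : ℝ => f (Γ (θ + t) + Γ (θ + t) - Γ (φ + θ + t))) 0| ≤
      (n + 2).factorial * K * (3 * D) ^ (n + 2) * φ ^ 2 := by
  have hn2 : 1 ≤ n + 2 := by omega
  have hK0 : 0 ≤ K := (norm_nonneg _).trans (hK 1 le_rfl hn2 0)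
  have hD0 : 0 ≤ D := by have := hD 1 le_rfl hn2 0; rw [pow_one] at this; exact (norm_nonneg _).trans this
  have hfN : ContDiff ℝ (n + 2 : ℕ) f := hf.of_le hn
  have hΓN : ContDiff ℝ (n + 2 : ℕ) Γ := hΓ.of_le hn
  have hfd : Differentiable ℝ f := hfN.differentiable (by exact_mod_cast (show n + 2 ≠ 0 by omega))
  have hΓd : Differentiable ℝ Γ := hΓN.differentiable (by exact_mod_cast (show n + 2 ≠ 0 by omega))
  -- the two-variable function `P(α, β) = f(2Γ(α) − Γ(β))`
  set L : ℝ × ℝ → V := fun x => Γ (ContinuousLinearMap.fst ℝ ℝ ℝ x) + Γ (ContinuousLinearMap.fst ℝ ℝ ℝ x) -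
    Γ (ContinuousLinearMap.snd ℝ ℝ ℝ x) with hL
  set P : ℝ × ℝ → ℝ := fun x => f (L x) with hP
  have hL1 : ContDiff ℝ (n + 2 : ℕ) (fun x : ℝ × ℝ => Γ (ContinuousLinearMap.fst ℝ ℝ ℝ x)) :=
    hΓN.comp (ContinuousLinearMap.fst ℝ ℝ ℝ).contDiff
  have hL2 : ContDiff ℝ (n + 2 : ℕ) (fun x : ℝ × ℝ => Γ (ContinuousLinearMap.snd ℝ ℝ ℝ x)) :=
    hΓN.comp (ContinuousLinearMap.snd ℝ ℝ ℝ).contDiff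
  have hLc : ContDiff ℝ (n + 2 : ℕ) L := (hL1.add hL1).sub hL2
  have hPc : ContDiff ℝ (n + 2 : ℕ) P := hfN.comp hLc
  set q : ℝ × ℝ := (θ, θ) with hq
  set v : ℝ × ℝ := (1, 1) with hv
  set w : ℝ × ℝ := (0, 1) with hw
  have hline : ∀ s t : ℝ, q + s • w + t • v = (θ + t, s + θ + t) := fun s t => by
    rw [hq, hv, hw]; refine Prod.ext ?_ ?_
    · simp
    · simp only [Prod.snd_add, Prod.smul_snd, smul_eq_mul, mul_one]; ring
  have hline0 : ∀ t : ℝ, q + t • v = (θ + t, θ + t) := fun t => by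
    have h := hline 0 t; rwa [zero_smul, add_zero, zero_add] at h
  have hLline : ∀ t : ℝ, L (q + t • v) = Γ (θ + t) := fun t => by
    rw [hline0 t, hL]; simp only [ContinuousLinearMap.coe_fst', ContinuousLinearMap.coe_snd', add_sub_cancel_right]
  -- the target function is `t ↦ P(q + φ w + t v)`
  have hfun : (fun t : ℝ => f (Γ (θ + t) + Γ (θ + t) - Γ (φ + θ + t))) = fun t : ℝ => P (q + φ • w + t • v) := by
    funext t; simp only [hline φ t, hP, hL, ContinuousLinearMap.coe_fst', ContinuousLinearMap.coe_snd']
  rw [hfun]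
  -- (a) `P` vanishes on the diagonal
  have h0 : ∀ t : ℝ, P (q + t • v) = 0 := fun t => by simp only [hP, hLline t, hΓ0]
  -- (b) `∂_w P` vanishes on the diagonal: it is minus the tangential derivative of `f` along `Γ`
  have h1 : ∀ t : ℝ, fderiv ℝ P (q + t • v) w = 0 := fun t => by
    set T : ℝ →L[ℝ] V := ContinuousLinearMap.toSpanSingleton ℝ (deriv Γ (θ + t)) with hT
    have ha : HasFDerivAt (fun x : ℝ × ℝ => Γ (ContinuousLinearMap.fst ℝ ℝ ℝ x)) (T.comp (ContinuousLinearMap.fst ℝ ℝ ℝ)) (q + t • v) := by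
      have h := ((hΓd _).hasDerivAt.hasFDerivAt).comp (q + t • v) (ContinuousLinearMap.fst ℝ ℝ ℝ).hasFDerivAt
      have e : ContinuousLinearMap.fst ℝ ℝ ℝ (q + t • v) = θ + t := by rw [hline0 t]; rfl
      rw [e] at h
      exact h
    have hb : HasFDerivAt (fun x : ℝ × ℝ => Γ (ContinuousLinearMap.snd ℝ ℝ ℝ x)) (T.comp (ContinuousLinearMap.snd ℝ ℝ ℝ)) (q + t • v) := by
      have h := ((hΓd _).hasDerivAt.hasFDerivAt).comp (q + t • v) (ContinuousLinearMap.snd ℝ ℝ ℝ).hasFDerivAt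
      have e : ContinuousLinearMap.snd ℝ ℝ ℝ (q + t • v) = θ + t := by rw [hline0 t]; rfl
      rw [e] at h
      exact h
    have hLd : HasFDerivAt L (T.comp (ContinuousLinearMap.fst ℝ ℝ ℝ) + T.comp (ContinuousLinearMap.fst ℝ ℝ ℝ) -
        T.comp (ContinuousLinearMap.snd ℝ ℝ ℝ)) (q + t • v) := (ha.add ha).sub hb
    have hPd : HasFDerivAt P ((fderiv ℝ f (L (q + t • v))).comp (T.comp (ContinuousLinearMap.fst ℝ ℝ ℝ) +
        T.comp (ContinuousLinearMap.fst ℝ ℝ ℝ) - T.comp (ContinuousLinearMap.snd ℝ ℝ ℝ))) (q + t • v) :=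
      (hfd _).hasFDerivAt.comp (q + t • v) hLd
    rw [hPd.fderiv, hLline t]
    simp [hw, hT, ContinuousLinearMap.toSpanSingleton_apply, fderiv_apply_deriv_eq_zero_of_level hfd hΓd hΓ0 (θ + t)]
  -- (c) the size of `D^{n+2}P`: composition bound with `‖DⁱL‖ ≤ 3Dⁱ ≤ (3D)ⁱ`
  have hM : ∀ x : ℝ × ℝ, ‖iteratedFDeriv ℝ (n + 2) P x‖ ≤ (n + 2).factorial * K * (3 * D) ^ (n + 2) := fun x => by
    -- shift `f` by the constant `f (L x)` so that the zeroth-order term of the composition bound vanishes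
    set g : V → ℝ := fun y => f y - f (L x) with hg
    have hgc : ContDiff ℝ (n + 2 : ℕ) g := hfN.sub contDiff_const
    have hshift : iteratedFDeriv ℝ (n + 2) P x = iteratedFDeriv ℝ (n + 2) (g ∘ L) x := by
      have e2 : g ∘ L = P - fun _ => f (L x) := rfl
      rw [e2, iteratedFDeriv_sub_apply hPc.contDiffAt contDiff_const.contDiffAt, iteratedFDeriv_const_of_ne (by omega : n + 2 ≠ 0)]
      simp only [Pi.zero_apply, sub_zero]
    rw [hshift]
    refine norm_iteratedFDeriv_comp_le hgc hLc le_rfl x (C := K) (D := 3 * D) (fun i hi => ?_) (fun i hi1 hi => ?_)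
    · -- `‖Dⁱg(L x)‖ ≤ K`: order 0 is `|f(Lx) − f(Lx)| = 0`, orders ≥ 1 are those of `f`
      rcases Nat.eq_zero_or_pos i with h0i | hpos
      · subst h0i; rw [norm_iteratedFDeriv_zero, hg]; simp only [sub_self, norm_zero]; exact hK0
      · have e : iteratedFDeriv ℝ i g (L x) = iteratedFDeriv ℝ i f (L x) := by
          have eg : g = f - fun _ => f (L x) := rfl
          rw [eg, iteratedFDeriv_sub_apply (hfN.of_le (by exact_mod_cast hi)).contDiffAt contDiff_const.contDiffAt,
            iteratedFDeriv_const_of_ne (by omega : i ≠ 0)]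
          simp only [Pi.zero_apply, sub_zero]
        rw [e]; exact hK i hpos hi _
    · -- `‖DⁱL(x)‖ ≤ 3·Dⁱ ≤ (3D)ⁱ`
      have hiN : (i : WithTop ℕ∞) ≤ (n + 2 : ℕ) := by exact_mod_cast hi
      have hfst : ‖ContinuousLinearMap.fst ℝ ℝ ℝ‖ ≤ 1 := ContinuousLinearMap.norm_fst_le ℝ ℝ ℝ
      have hsnd : ‖ContinuousLinearMap.snd ℝ ℝ ℝ‖ ≤ 1 := ContinuousLinearMap.norm_snd_le ℝ ℝ ℝ
      have t1 := norm_iteratedFDeriv_comp_clm_le hΓN (ContinuousLinearMap.fst ℝ ℝ ℝ) hfst hiN x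
      have t2 := norm_iteratedFDeriv_comp_clm_le hΓN (ContinuousLinearMap.snd ℝ ℝ ℝ) hsnd hiN x
      have d1 := hD i hi1 hi (ContinuousLinearMap.fst ℝ ℝ ℝ x)
      have d2 := hD i hi1 hi (ContinuousLinearMap.snd ℝ ℝ ℝ x)
      have hadd : iteratedFDeriv ℝ i L x = iteratedFDeriv ℝ i (fun x : ℝ × ℝ => Γ (ContinuousLinearMap.fst ℝ ℝ ℝ x)) x +
          iteratedFDeriv ℝ i (fun x : ℝ × ℝ => Γ (ContinuousLinearMap.fst ℝ ℝ ℝ x)) x -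
          iteratedFDeriv ℝ i (fun x : ℝ × ℝ => Γ (ContinuousLinearMap.snd ℝ ℝ ℝ x)) x := by
        have hi' : ContDiffAt ℝ i (fun x : ℝ × ℝ => Γ (ContinuousLinearMap.fst ℝ ℝ ℝ x)) x := (hL1.of_le hiN).contDiffAt
        have hi'' : ContDiffAt ℝ i (fun x : ℝ × ℝ => Γ (ContinuousLinearMap.snd ℝ ℝ ℝ x)) x := (hL2.of_le hiN).contDiffAt
        have eL : L = ((fun x : ℝ × ℝ => Γ (ContinuousLinearMap.fst ℝ ℝ ℝ x)) + fun x : ℝ × ℝ => Γ (ContinuousLinearMap.fst ℝ ℝ ℝ x)) -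
            fun x : ℝ × ℝ => Γ (ContinuousLinearMap.snd ℝ ℝ ℝ x) := rfl
        rw [eL, iteratedFDeriv_sub_apply (f := (fun x : ℝ × ℝ => Γ (ContinuousLinearMap.fst ℝ ℝ ℝ x)) + fun x : ℝ × ℝ =>
            Γ (ContinuousLinearMap.fst ℝ ℝ ℝ x)) (hi'.add hi') hi'', iteratedFDeriv_add_apply hi' hi']
      have hpow : 3 * D ^ i ≤ (3 * D) ^ i := by
        rw [mul_pow]
        have h3 : (3 : ℝ) ≤ 3 ^ i := by
          calc (3 : ℝ) = 3 ^ 1 := (pow_one _).symm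
            _ ≤ 3 ^ i := pow_le_pow_right₀ (by norm_num) hi1
        exact mul_le_mul_of_nonneg_right h3 (pow_nonneg hD0 i)
      rw [hadd]
      refine ((norm_sub_le _ _).trans (add_le_add (norm_add_le _ _) le_rfl)).trans ?_
      linarith
  -- (d) assemble
  have hvn : ‖v‖ = 1 := by rw [hv]; simp [Prod.norm_def]
  have hwn : ‖w‖ = 1 := by rw [hw]; simp [Prod.norm_def]
  have h := abs_iteratedFDeriv_line_le_sq (hPc.of_le le_rfl) le_rfl q v w h0 h1 (φ := φ) (fun s _ => hM (q + s • w))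
  rw [hvn, hwn, one_pow, one_pow, mul_one, mul_one] at h
  exact h

end Core


end Summit.HubbardSuperconductivity.HubbardSuperconductivity.Theorems.C4a

end
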